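import Mathlib
import Summits.NavierStokesRegularity.NavierStokesRegularity.Theorems.FilamentSkeletonRssStadiumDeviationRatio
import Summits.NavierStokesRegularity.NavierStokesRegularity.Theorems.FilamentSkeletonRssStadiumSegmentPositivity

/-!
# Principal branch of the complexified chord for a PAIR OF STADIUM POINTS (`TangentSkeletonNearStraightL`, stmt-NavierStokesRegularity-23320,
# registered stub `stub_stripPropagation` — the contour-shift positivity in the stub's own terms, every `Rb`, any disc ratio `n > 1`)

Setting of the stub: rectangle stadium `S = {|Im z| < hs, |Re z − cc| < L + hs}`, `F : ℂ → ℂ³` holomorphic on `S` with the bilinear unit relation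
`Σ (F′)ᵢ² = 1` (Theorems.StadiumBilinearUnitSpeed), `F = cplx ∘ X` on the real trace, `‖F′‖ ≤ M` on `S`, `X` differentiable with `‖X′‖ = 1` and tangent
oscillation `‖X′(τ) − X′(σ)‖ ≤ Rb`.  For a target `z` and a source `ζ` in the closed upper half of `S` whose `n`-fold discs fit
(`n·Im < hs`, `|Re − cc| + n·Im < L + hs` at BOTH points — then along the whole segment, by convexity) and with `Re((z−ζ)²) ≥ 0`:
  `Re Σᵢ (Fᵢ(z) − Fᵢ(ζ))² ≥ Re((z−ζ)²)·(1 − (Rb + 2E)²/2) − |Im((z−ζ)²)|·(2Q(Rb + 2E))`,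
  `E = √3·2M(log(n/(n−1)) − 1/n)`, `Q = √3·M·log(n/(n−1))` (`pair_chord_re_ge`);
slope form (`|Im(z−ζ)| ≤ m·|Re(z−ζ)|`, `m ≤ 1`): `≥ (Re(z−ζ))²·((1−m²)(1 − (Rb+2E)²/2) − 2m·2Q(Rb+2E))` (`pair_chord_re_ge_slope`); with the matched core
(`Re G(ζ) ≥ A/2`, `κ ≥ 0`): add `κA/2` (`pair_base_re_ge_slope`).  Numbers (`M = 2`): ratio `n = 14` (output half-width `cs√Γ/16`): horizontal `0.856·(Δx)²`,
slope `2/7`: `0.59·(Δx)²` for every `Rb ≤ 1/2`; ratio 4 with the forced end slope 1/3 (registered `cs√Γ/4`): negative — see evidence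
`DIAG-stripPropagation-ends-g2.md` on 23320.  Assembles Theorems.StadiumDeviationRatio (pointwise `e`, `q` along the segment) into
Theorems.StadiumSegmentPositivity.segment_chord_re_ge.  HONEST FRAMING: a tool for a HYPOTHETICAL filament skeleton on the NEGATIVE side of a MODEL route;
nothing here bears on Navier–Stokes regularity or blow-up.  `--supports stmt-NavierStokesRegularity-23320`.
-/

set_option linter.dupNamespace false

noncomputable section

namespace Summit.NavierStokesRegularity.NavierStokesRegularity.Theorems.StadiumContourPositivity

open Set Metric
open scoped InnerProductSpace
open Summit.NavierStokesRegularity.NavierStokesRegularity.Theorems.StadiumDeviationRatio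
open Summit.NavierStokesRegularity.NavierStokesRegularity.Theorems.StadiumDeviationPackage
open Summit.NavierStokesRegularity.NavierStokesRegularity.Theorems.StadiumSegmentPositivity

/-- **Pair chord positivity in the stadium.**  See the module docstring. [folklore] -/
theorem pair_chord_re_ge {hs L cc M Rb n : ℝ} {F : ℂ → (Fin 3 → ℂ)}
    (hF : DifferentiableOn ℂ F {z : ℂ | |z.im| < hs ∧ |z.re - cc| < L + hs})
    (hunit : ∀ w ∈ {z : ℂ | |z.im| < hs ∧ |z.re - cc| < L + hs}, ∑ i, (deriv F w i) ^ 2 = 1)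
    (hM : ∀ z ∈ {z : ℂ | |z.im| < hs ∧ |z.re - cc| < L + hs}, ‖deriv F z‖ ≤ M)
    {X : ℝ → EuclideanSpace ℝ (Fin 3)} (hX : Differentiable ℝ X) (hXu : ∀ τ, ‖deriv X τ‖ = 1)
    (hosc : ∀ τ σ, ‖deriv X τ - deriv X σ‖ ≤ Rb)
    (hFX : ∀ r : ℝ, (r : ℂ) ∈ {z : ℂ | |z.im| < hs ∧ |z.re - cc| < L + hs} →
      F r = fun i => ((⟪X r, EuclideanSpace.single i (1:ℝ)⟫_ℝ : ℝ) : ℂ))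
    (hn : 1 < n) {z ζ : ℂ} (hz0 : 0 ≤ z.im) (hζ0 : 0 ≤ ζ.im)
    (hzfit : n * z.im < hs) (hzfit' : |z.re - cc| + n * z.im < L + hs)
    (hζfit : n * ζ.im < hs) (hζfit' : |ζ.re - cc| + n * ζ.im < L + hs)
    (hre : 0 ≤ ((z - ζ) ^ 2).re) :
    ((z - ζ) ^ 2).re * (1 - (Rb + 2 * (√3 * (2 * M * (Real.log (n / (n - 1)) - 1 / n)))) ^ 2 / 2) -
      |((z - ζ) ^ 2).im| * (2 * (√3 * (M * Real.log (n / (n - 1)))) * (Rb + 2 * (√3 * (2 * M * (Real.log (n / (n - 1)) - 1 / n))))) ≤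
      (∑ i, (F z i - F ζ i) ^ 2).re := by
  set S : Set ℂ := {z : ℂ | |z.im| < hs ∧ |z.re - cc| < L + hs} with hS
  have hSo : IsOpen S := by
    have h1 : IsOpen {z : ℂ | |z.im| < hs} := isOpen_lt (continuous_abs.comp Complex.continuous_im) continuous_const
    have h2 : IsOpen {z : ℂ | |z.re - cc| < L + hs} :=
      isOpen_lt (continuous_abs.comp (Complex.continuous_re.sub continuous_const)) continuous_const
    exact h1.inter h2
  have hn0 : 0 < n := by linarith
  have hhs : 0 < hs := by nlinarith
  set s : ℂ := z - ζ with hsdef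
  -- the segment point `w r = ζ + r·s` and its coordinates
  have hw_im : ∀ r : ℝ, (ζ + (r : ℂ) * s).im = ζ.im + r * (z.im - ζ.im) := by
    intro r; simp [hsdef]
  have hw_re : ∀ r : ℝ, (ζ + (r : ℂ) * s).re = ζ.re + r * (z.re - ζ.re) := by
    intro r; simp [hsdef]
  -- along the segment: nonnegative height, discs fit
  have hfit : ∀ r ∈ Icc (0:ℝ) 1, 0 ≤ (ζ + (r : ℂ) * s).im ∧ n * (ζ + (r : ℂ) * s).im < hs ∧
      |(ζ + (r : ℂ) * s).re - cc| + n * (ζ + (r : ℂ) * s).im < L + hs ∧ |(ζ + (r : ℂ) * s).re - cc| < L + hs := by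
    intro r hr
    rw [hw_im r, hw_re r]
    have hr0 := hr.1; have hr1 := hr.2
    have him0 : 0 ≤ ζ.im + r * (z.im - ζ.im) := by nlinarith
    have him1 : n * (ζ.im + r * (z.im - ζ.im)) < hs := by
      have : n * (ζ.im + r * (z.im - ζ.im)) = (1 - r) * (n * ζ.im) + r * (n * z.im) := by ring
      rw [this]
      rcases eq_or_lt_of_le hr0 with h0 | h0
      · rw [← h0]; simpa using hζfit
      · nlinarith
    have habs : |ζ.re + r * (z.re - ζ.re) - cc| ≤ (1 - r) * |ζ.re - cc| + r * |z.re - cc| := by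
      have e : ζ.re + r * (z.re - ζ.re) - cc = (1 - r) * (ζ.re - cc) + r * (z.re - cc) := by ring
      rw [e]
      calc |(1 - r) * (ζ.re - cc) + r * (z.re - cc)| ≤ |(1 - r) * (ζ.re - cc)| + |r * (z.re - cc)| := abs_add_le _ _
        _ = (1 - r) * |ζ.re - cc| + r * |z.re - cc| := by
            rw [abs_mul, abs_mul, abs_of_nonneg (by linarith : (0:ℝ) ≤ 1 - r), abs_of_nonneg hr0]
    have hsum : (1 - r) * |ζ.re - cc| + r * |z.re - cc| + n * (ζ.im + r * (z.im - ζ.im)) < L + hs := by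
      have e : (1 - r) * |ζ.re - cc| + r * |z.re - cc| + n * (ζ.im + r * (z.im - ζ.im)) =
          (1 - r) * (|ζ.re - cc| + n * ζ.im) + r * (|z.re - cc| + n * z.im) := by ring
      rw [e]
      rcases eq_or_lt_of_le hr0 with h0 | h0
      · rw [← h0]; simpa using hζfit'
      · nlinarith
    refine ⟨him0, him1, by linarith, ?_⟩
    have : 0 ≤ n * (ζ.im + r * (z.im - ζ.im)) := by positivity
    linarith
  have hseg : ∀ r ∈ Icc (0:ℝ) 1, ζ + (r : ℂ) * s ∈ S := by
    intro r hr
    obtain ⟨h0, h1, -, h3⟩ := hfit r hr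
    refine ⟨?_, h3⟩
    rw [abs_of_nonneg h0]
    nlinarith
  -- the real unit tangent field along the segment
  set T : ℝ → Fin 3 → ℝ := fun r i => ⟪deriv X ((ζ + (r : ℂ) * s).re), EuclideanSpace.single i (1:ℝ)⟫_ℝ with hT
  have hTu : ∀ r ∈ Icc (0:ℝ) 1, ∑ i, T r i ^ 2 = 1 := fun r _ =>
    (unit_tangent_coords hXu hosc ((ζ + (r : ℂ) * s).re) 0).1
  have hρ : ∀ r ∈ Icc (0:ℝ) 1, ∀ r' ∈ Icc (0:ℝ) 1, √(∑ i, (T r i - T r' i) ^ 2) ≤ Rb := fun r _ r' _ =>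
    (unit_tangent_coords hXu hosc ((ζ + (r : ℂ) * s).re) ((ζ + (r' : ℂ) * s).re)).2
  -- the point `w r` written as `x + it`
  have hxy : ∀ r : ℝ, ζ + (r : ℂ) * s = (((ζ + (r : ℂ) * s).re : ℝ) : ℂ) + (((ζ + (r : ℂ) * s).im : ℝ) : ℂ) * Complex.I :=
    fun r => (Complex.re_add_im _).symm
  have he : ∀ r ∈ Icc (0:ℝ) 1, √(∑ i, ((deriv F (ζ + (r : ℂ) * s) i).re - T r i) ^ 2) ≤
      √3 * (2 * M * (Real.log (n / (n - 1)) - 1 / n)) := by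
    intro r hr
    obtain ⟨h0, h1, h2, h3⟩ := hfit r hr
    have h := euclid_re_dev_le_ratio hF hM hX hFX hn h0 h1 h2 hhs h3
    rw [← hxy r] at h
    exact h
  have hq : ∀ r ∈ Icc (0:ℝ) 1, √(∑ i, (deriv F (ζ + (r : ℂ) * s) i).im ^ 2) ≤ √3 * (M * Real.log (n / (n - 1))) := by
    intro r hr
    obtain ⟨h0, h1, h2, h3⟩ := hfit r hr
    have h := euclid_im_le_ratio hF hM hX hFX hn h0 h1 h2 hhs h3
    rw [← hxy r] at h
    exact h
  have hmain := segment_chord_re_ge hSo hF hunit hseg T hTu hρ he hq (by simpa [hsdef] using hre)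
  have ez : ζ + s = z := by simp [hsdef]
  rw [ez] at hmain
  simpa [hsdef] using hmain

/-- **Slope form.**  If moreover `|Im(z−ζ)| ≤ m·|Re(z−ζ)|` with `0 ≤ m ≤ 1` and the horizontal coefficient is nonnegative, then
`Re Q ≥ (Re(z−ζ))²·((1−m²)·(1 − (Rb+2E)²/2) − 2m·(2Q(Rb+2E)))`. [folklore] -/
theorem pair_chord_re_ge_slope {hs L cc M Rb n m : ℝ} {F : ℂ → (Fin 3 → ℂ)}
    (hF : DifferentiableOn ℂ F {z : ℂ | |z.im| < hs ∧ |z.re - cc| < L + hs})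
    (hunit : ∀ w ∈ {z : ℂ | |z.im| < hs ∧ |z.re - cc| < L + hs}, ∑ i, (deriv F w i) ^ 2 = 1)
    (hM : ∀ z ∈ {z : ℂ | |z.im| < hs ∧ |z.re - cc| < L + hs}, ‖deriv F z‖ ≤ M)
    {X : ℝ → EuclideanSpace ℝ (Fin 3)} (hX : Differentiable ℝ X) (hXu : ∀ τ, ‖deriv X τ‖ = 1)
    (hosc : ∀ τ σ, ‖deriv X τ - deriv X σ‖ ≤ Rb)
    (hFX : ∀ r : ℝ, (r : ℂ) ∈ {z : ℂ | |z.im| < hs ∧ |z.re - cc| < L + hs} →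
      F r = fun i => ((⟪X r, EuclideanSpace.single i (1:ℝ)⟫_ℝ : ℝ) : ℂ))
    (hn : 1 < n) {z ζ : ℂ} (hz0 : 0 ≤ z.im) (hζ0 : 0 ≤ ζ.im)
    (hzfit : n * z.im < hs) (hzfit' : |z.re - cc| + n * z.im < L + hs)
    (hζfit : n * ζ.im < hs) (hζfit' : |ζ.re - cc| + n * ζ.im < L + hs)
    (hm0 : 0 ≤ m) (hm1 : m ≤ 1) (hslope : |z.im - ζ.im| ≤ m * |z.re - ζ.re|)
    (hA : 0 ≤ 1 - (Rb + 2 * (√3 * (2 * M * (Real.log (n / (n - 1)) - 1 / n)))) ^ 2 / 2) :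
    (z.re - ζ.re) ^ 2 * ((1 - m ^ 2) * (1 - (Rb + 2 * (√3 * (2 * M * (Real.log (n / (n - 1)) - 1 / n)))) ^ 2 / 2) -
      2 * m * (2 * (√3 * (M * Real.log (n / (n - 1)))) * (Rb + 2 * (√3 * (2 * M * (Real.log (n / (n - 1)) - 1 / n)))))) ≤
      (∑ i, (F z i - F ζ i) ^ 2).re := by
  set A₁ : ℝ := 1 - (Rb + 2 * (√3 * (2 * M * (Real.log (n / (n - 1)) - 1 / n)))) ^ 2 / 2 with hA₁
  set A₂ : ℝ := 2 * (√3 * (M * Real.log (n / (n - 1)))) * (Rb + 2 * (√3 * (2 * M * (Real.log (n / (n - 1)) - 1 / n)))) with hA₂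
  have hre2 : ((z - ζ) ^ 2).re = (z.re - ζ.re) ^ 2 - (z.im - ζ.im) ^ 2 := by
    rw [sq, Complex.mul_re, Complex.sub_re, Complex.sub_im]; ring
  have him2 : ((z - ζ) ^ 2).im = 2 * (z.re - ζ.re) * (z.im - ζ.im) := by
    rw [sq, Complex.mul_im, Complex.sub_re, Complex.sub_im]; ring
  have hdy2 : (z.im - ζ.im) ^ 2 ≤ m ^ 2 * (z.re - ζ.re) ^ 2 := by
    have h := mul_self_le_mul_self (abs_nonneg _) hslope
    rw [← sq, ← sq, sq_abs, mul_pow, sq_abs] at h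
    exact h
  have hre_ge : (1 - m ^ 2) * (z.re - ζ.re) ^ 2 ≤ ((z - ζ) ^ 2).re := by rw [hre2]; nlinarith
  have hre0 : 0 ≤ ((z - ζ) ^ 2).re := by
    have : 0 ≤ (1 - m ^ 2) * (z.re - ζ.re) ^ 2 := mul_nonneg (by nlinarith) (sq_nonneg _)
    linarith
  have him_le : |((z - ζ) ^ 2).im| ≤ 2 * m * (z.re - ζ.re) ^ 2 := by
    rw [him2, abs_mul, abs_mul, abs_two]
    have h1 : |z.re - ζ.re| * |z.im - ζ.im| ≤ |z.re - ζ.re| * (m * |z.re - ζ.re|) :=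
      mul_le_mul_of_nonneg_left hslope (abs_nonneg _)
    have e : |z.re - ζ.re| * (m * |z.re - ζ.re|) = m * (z.re - ζ.re) ^ 2 := by
      rw [← sq_abs]; ring
    nlinarith [abs_nonneg (z.re - ζ.re), abs_nonneg (z.im - ζ.im)]
  have hmain := pair_chord_re_ge hF hunit hM hX hXu hosc hFX hn hz0 hζ0 hzfit hzfit' hζfit hζfit' hre0
  rw [← hA₁, ← hA₂] at hmain
  -- `A₂ ≥ 0`
  have hn0 : 0 < n := by linarith
  have hhs : 0 < hs := by nlinarith
  have hxS : ((z.re : ℝ) : ℂ) ∈ {z : ℂ | |z.im| < hs ∧ |z.re - cc| < L + hs} := by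
    refine ⟨by simpa using hhs, ?_⟩
    simp only [Complex.ofReal_re]
    have : 0 ≤ n * z.im := by positivity
    linarith
  have hM0 : 0 ≤ M := (norm_nonneg _).trans (hM _ hxS)
  have hlog0 : 0 ≤ Real.log (n / (n - 1)) := le_trans (by positivity) (inv_le_log_ratio hn)
  have hlog1 : 0 ≤ Real.log (n / (n - 1)) - 1 / n := by linarith [inv_le_log_ratio hn]
  have hRb : 0 ≤ Rb := le_trans (norm_nonneg _) (hosc 0 0)
  have hA₂0 : 0 ≤ A₂ := by rw [hA₂]; positivity
  have h1 : (1 - m ^ 2) * (z.re - ζ.re) ^ 2 * A₁ ≤ ((z - ζ) ^ 2).re * A₁ := mul_le_mul_of_nonneg_right hre_ge hA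
  have h2 : |((z - ζ) ^ 2).im| * A₂ ≤ 2 * m * (z.re - ζ.re) ^ 2 * A₂ := mul_le_mul_of_nonneg_right him_le hA₂0
  have e : (z.re - ζ.re) ^ 2 * ((1 - m ^ 2) * A₁ - 2 * m * A₂) =
      (1 - m ^ 2) * (z.re - ζ.re) ^ 2 * A₁ - 2 * m * (z.re - ζ.re) ^ 2 * A₂ := by ring
  rw [e]
  linarith

/-- **With the matched core** (`Re G(ζ) ≥ A/2`, `κ ≥ 0`): the kernel base `Q + κ·G(ζ)` has real part at least the slope bound plus `κA/2`;
in particular it lies in the open right half-plane as soon as the slope coefficient is nonnegative and `κA > 0` (principal branch). [folklore] -/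
theorem pair_base_re_ge_slope {hs L cc M Rb n m : ℝ} {F : ℂ → (Fin 3 → ℂ)}
    (hF : DifferentiableOn ℂ F {z : ℂ | |z.im| < hs ∧ |z.re - cc| < L + hs})
    (hunit : ∀ w ∈ {z : ℂ | |z.im| < hs ∧ |z.re - cc| < L + hs}, ∑ i, (deriv F w i) ^ 2 = 1)
    (hM : ∀ z ∈ {z : ℂ | |z.im| < hs ∧ |z.re - cc| < L + hs}, ‖deriv F z‖ ≤ M)
    {X : ℝ → EuclideanSpace ℝ (Fin 3)} (hX : Differentiable ℝ X) (hXu : ∀ τ, ‖deriv X τ‖ = 1)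
    (hosc : ∀ τ σ, ‖deriv X τ - deriv X σ‖ ≤ Rb)
    (hFX : ∀ r : ℝ, (r : ℂ) ∈ {z : ℂ | |z.im| < hs ∧ |z.re - cc| < L + hs} →
      F r = fun i => ((⟪X r, EuclideanSpace.single i (1:ℝ)⟫_ℝ : ℝ) : ℂ))
    (hn : 1 < n) {z ζ : ℂ} (hz0 : 0 ≤ z.im) (hζ0 : 0 ≤ ζ.im)
    (hzfit : n * z.im < hs) (hzfit' : |z.re - cc| + n * z.im < L + hs)
    (hζfit : n * ζ.im < hs) (hζfit' : |ζ.re - cc| + n * ζ.im < L + hs)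
    (hm0 : 0 ≤ m) (hm1 : m ≤ 1) (hslope : |z.im - ζ.im| ≤ m * |z.re - ζ.re|)
    (hA : 0 ≤ 1 - (Rb + 2 * (√3 * (2 * M * (Real.log (n / (n - 1)) - 1 / n)))) ^ 2 / 2)
    {κ Ar : ℝ} {Gv : ℂ} (hκ : 0 ≤ κ) (hG : Ar / 2 ≤ Gv.re) :
    (z.re - ζ.re) ^ 2 * ((1 - m ^ 2) * (1 - (Rb + 2 * (√3 * (2 * M * (Real.log (n / (n - 1)) - 1 / n)))) ^ 2 / 2) -
      2 * m * (2 * (√3 * (M * Real.log (n / (n - 1)))) * (Rb + 2 * (√3 * (2 * M * (Real.log (n / (n - 1)) - 1 / n)))))) +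
      κ * (Ar / 2) ≤ ((∑ i, (F z i - F ζ i) ^ 2) + (κ : ℂ) * Gv).re := by
  have h := pair_chord_re_ge_slope hF hunit hM hX hXu hosc hFX hn hz0 hζ0 hzfit hzfit' hζfit hζfit' hm0 hm1 hslope hA
  rw [Complex.add_re, Complex.re_ofReal_mul]
  have h2 : κ * (Ar / 2) ≤ κ * Gv.re := mul_le_mul_of_nonneg_left hG hκ
  linarith

end Summit.NavierStokesRegularity.NavierStokesRegularity.Theorems.StadiumContourPositivity

end
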